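import Mathlib.Algebra.QuadraticAlgebra.Basic
import Literature.Computability.Cryptography.HallgrenClassGroupFormGroup
import HarnessLib

/-!
# Hallgren 2005 / class numbers under GRH — step Q1d (i): the quadratic order `ℤ[ω_D]` of an
# arbitrary negative discriminant and the ideal classes of forms

Topic `Literature/Computability/Cryptography`; proof companion of `HallgrenClassGroup.lean`
(named fact `Hallgren2005_classNumber_qsolvable_of_GRH`). Real definitions and theorems; no named
fact.

The quantum sub-problem of the class-number algorithm ("the order of the subgroup of the form
class group generated by given reduced forms") must be a TOTAL language in `BQP`, hence correct on
every input passing a polynomial-time checkable promise; "`−d` is a fundamental discriminant" is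
not such a promise (square-freeness), so the analysis is carried out for EVERY negative
discriminant `D`, i.e. for the (possibly non-maximal) quadratic order
`O_D = ℤ[ω]`, `ω² = m(D) + D ω` (`m(D) = ⌊(D − D²)/4⌋`), realised as Mathlib's
`QuadraticAlgebra ℤ (mOf D) D`. The composition algebra of `HallgrenClassGroupComposition.lean`
(§Ring) is already generic in such a ring. This file:

* `NegDiscr` (bundled `D < 0`), `QO Δ = QuadraticAlgebra ℤ (mOf D) D`, its basis `(1, ω)`,
  `omega_mul_omega`, the norm identity `four_mul_norm`, **`IsDomain (QO Δ)`** (the norm form is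
  positive definite since `D² + 4 m(D) ≤ D < 0`);
* the form ideal `fIdeal Δ f = (a, ω − k(f))`, the opposite form `negForm`, and
  **`fIdeal_mul_negForm`**: `𝔞_f · 𝔞_{f̄} = (a)` for a primitive form (Cox, Prop. 7.4 / Lemma 7.5:
  the ideals of primitive forms are invertible);
* the unit fractional ideal `fUnit` and the class **`classOf' Δ f ∈ Cl(O_D)`** (Mathlib's
  `ClassGroup` of a domain: invertible fractional ideals modulo principal ones), with
  `classOf'_eq_classOf'_iff` (`x 𝔞_f = y 𝔞_g`), `classOf'_one`, `classOf'_mul_negForm`;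
* **`isPosPrim_rawCompose'`** — the composite of primitive forms is primitive for EVERY `D < 0`
  (invertible ideals are proper: `(ω − K)/e ∈ O_D` forces `e = ±1`), and
  **`classOf'_rawCompose`**: `[𝔞_{f∘g}] = [𝔞_f][𝔞_g]`;
* invariance under the Gauss moves: `fIdeal_normalizeB` (translation does not change the ideal),
  `span_mul_fIdeal_swapS` (`(ω − k) 𝔞_{fS} = c 𝔞_f`), hence `classOf'_step`, `classOf'_reduce`,
  and **`classOf'_compose`**, `isPosPrim_compose'`, `isReduced_compose'`.

## References

* D. A. Cox, *Primes of the form x² + ny²*, 2nd ed. (2013), §7.A Prop. 7.4, Lemma 7.5, §7.B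
  Thm. 7.7, §2.A Thm. 2.8, §3.A [Cox2013].
* A. M. Childs, W. van Dam, Rev. Mod. Phys. 82 (2010), §5.7 [ChildsVandam2010].
-/

noncomputable section

open scoped nonZeroDivisors QuadraticAlgebra

namespace Literature.Computability.Cryptography.Hallgren2005

namespace OrderCl

open Module QuadraticAlgebra
open Literature.NumberTheory.QuadraticFields.Quadratic Literature.NumberTheory.QuadraticFields.Quadratic.BinQF
open FormComposition Composition Reduction

/-! ### The order `O_D = ℤ[ω]` -/

/-- A negative discriminant, bundled (the index of the family of orders `O_D`). [folklore] -/
structure NegDiscr where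
  /-- the discriminant -/
  D : ℤ
  /-- negativity -/
  neg : D < 0

/-- **The quadratic order `O_D = ℤ[ω]`, `ω² = m(D) + D ω`** (so `ω = (D + √D)/2` when
`D ≡ 0, 1 (mod 4)`). [cite: Cox2013, §7.A (orders in quadratic fields)] -/
abbrev QO (Δ : NegDiscr) : Type := QuadraticAlgebra ℤ (mOf Δ.D) Δ.D

variable (Δ : NegDiscr)

/-- The `ℤ`-basis `(1, ω)` of `O_D`. [folklore] -/
abbrev qbasis : Basis (Fin 2) ℤ (QO Δ) := QuadraticAlgebra.basis (mOf Δ.D) Δ.D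

/-- `qbasis 0 = 1`. [folklore] -/
theorem qbasis_zero : qbasis Δ 0 = 1 := by
  rw [qbasis, QuadraticAlgebra.basis, Basis.coe_ofEquivFun]
  ext <;> simp

/-- `qbasis 1 = ω`. [folklore] -/
theorem qbasis_one : qbasis Δ 1 = ω := by
  rw [qbasis, QuadraticAlgebra.basis, Basis.coe_ofEquivFun]
  ext <;> simp [omega]

/-- `ω² = m(D) + D ω`. [folklore] -/
theorem omega_mul_omega : (ω : QO Δ) * ω = (mOf Δ.D : QO Δ) + (Δ.D : QO Δ) * ω := by
  ext <;> simp [omega]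

/-- The basis relation in the form used by `HallgrenClassGroupComposition` (§Ring). [folklore] -/
theorem qbasis_rel : qbasis Δ 1 * qbasis Δ 1 = (mOf Δ.D : QO Δ) + (Δ.D : QO Δ) * qbasis Δ 1 := by
  rw [qbasis_one]; exact omega_mul_omega Δ

/-- `4 N(x + yω) = (2x + Dy)² − (D² + 4m(D)) y²`. [folklore] -/
theorem four_mul_norm (z : QO Δ) :
    4 * z.norm = (2 * z.re + Δ.D * z.im) ^ 2 - (Δ.D ^ 2 + 4 * mOf Δ.D) * z.im ^ 2 := by
  rw [norm_def]; ring

/-- `D² + 4 m(D) ≤ D` (floor division; equality for `D ≡ 0, 1 (mod 4)`). [folklore] -/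
theorem sq_add_four_mul_mOf_le : Δ.D ^ 2 + 4 * mOf Δ.D ≤ Δ.D := by
  have := Int.mul_ediv_self_le (x := Δ.D - Δ.D ^ 2) (k := 4) (by norm_num)
  rw [mOf]; linarith

/-- **The norm form of `O_D` is positive definite.** [folklore] -/
theorem norm_pos {z : QO Δ} (hz : z ≠ 0) : 0 < z.norm := by
  have h4 := four_mul_norm Δ z
  have hle := sq_add_four_mul_mOf_le Δ
  have hD := Δ.neg
  by_cases him : z.im = 0
  · have hre : z.re ≠ 0 := by
      intro hre; apply hz; ext <;> simp [hre, him]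
    have : 0 < (2 * z.re + Δ.D * z.im) ^ 2 := by
      rw [him, mul_zero, add_zero]; positivity
    nlinarith [sq_nonneg z.im]
  · have h1 : 0 < z.im ^ 2 := by positivity
    have h2 : 0 < -(Δ.D ^ 2 + 4 * mOf Δ.D) * z.im ^ 2 := mul_pos (by linarith) h1
    nlinarith [sq_nonneg (2 * z.re + Δ.D * z.im)]

/-- `O_D` is an integral domain (`D < 0`). [cite: Cox2013, §7.A] -/
instance instIsDomain : IsDomain (QO Δ) := by
  haveI : NoZeroDivisors (QO Δ) := ⟨fun {x y} h => by
    by_contra hxy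
    rw [not_or] at hxy
    have hx := norm_pos Δ hxy.1
    have hy := norm_pos Δ hxy.2
    have : (x * y).norm = 0 := by rw [h, QuadraticAlgebra.norm_zero]
    rw [map_mul] at this
    nlinarith⟩
  exact NoZeroDivisors.to_isDomain _

/-- Nonzero integers are nonzero in `O_D`. [folklore] -/
theorem intCast_ne_zero {n : ℤ} (hn : n ≠ 0) : (n : QO Δ) ≠ 0 := by
  intro h
  have := congrArg QuadraticAlgebra.re h
  simp at this
  exact hn this

/-- Divisibility by an integer in `O_D` is coordinatewise. [folklore] -/
theorem intCast_dvd_iff {n : ℤ} {z : QO Δ} : (n : QO Δ) ∣ z ↔ n ∣ z.re ∧ n ∣ z.im := by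
  rw [← C_intCast, C_eq_algebraMap]
  exact algebraMap_dvd_iff

/-! ### Form ideals and the opposite form -/

/-- The ideal `𝔞_f = (a, ω − k(f))` of a form in `O_D`. [cite: Cox2013, §7.B Thm. 7.7 (the ideal [a, (−b+√D)/2])] -/
def fIdeal (f : BinQF) : Ideal (QO Δ) := Ideal.span {(f.a : QO Δ), ω - (kOf Δ.D f : QO Δ)}

/-- The opposite form `(a, −b, c)` (the inverse class). [cite: Cox2013, §3.A (the opposite form)] -/
def negForm (f : BinQF) : BinQF := ⟨f.a, -f.b, f.c⟩

variable {Δ}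

/-- The opposite form is primitive positive definite of the same discriminant. [folklore] -/
theorem isPosPrim_negForm {f : BinQF} (hf : f.IsPosPrim Δ.D) : (negForm f).IsPosPrim Δ.D := by
  refine ⟨by rw [← hf.disc_eq]; simp [negForm, BinQF.disc], hf.a_pos, ?_⟩
  have hp := hf.primitive
  unfold BinQF.IsPrimitive at hp ⊢
  simpa [negForm] using hp

/-- `k(f̄) = D − k(f)`. [folklore] -/
theorem kOf_negForm {f : BinQF} (hf : f.disc = Δ.D) : kOf Δ.D (negForm f) = Δ.D - kOf Δ.D f := by
  have h1 := two_mul_kOf hf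
  have h2 := two_mul_kOf (show (negForm f).disc = Δ.D by rw [← hf]; simp [negForm, BinQF.disc])
  have hb : (negForm f).b = -f.b := rfl
  rw [hb] at h2
  linarith

/-- `(ω − k)(ω − (D − k)) = −ac` in `O_D` (the norm relation `ac = k² − Dk − m`). [cite: Cox2013, §7.B Thm. 7.7] -/
theorem omega_sub_mul_omega_sub {f : BinQF} (hf : f.IsPosPrim Δ.D) :
    ((ω : QO Δ) - (kOf Δ.D f : QO Δ)) * (ω - ((Δ.D - kOf Δ.D f : ℤ) : QO Δ)) = -((f.a * f.c : ℤ) : QO Δ) := by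
  have hn := norm_eq hf.disc_eq hf.emod_four
  have hω := omega_mul_omega Δ
  have hcast : ((f.a * f.c : ℤ) : QO Δ) = ((kOf Δ.D f ^ 2 - Δ.D * kOf Δ.D f - mOf Δ.D : ℤ) : QO Δ) := by
    rw [hn]
  push_cast at hcast ⊢
  linear_combination hω + hcast

/-- `(ω − (D − k)) − (ω − k)`… precisely `(ω − k̄) = (ω − k) − b` with `b = 2k − D`. [folklore] -/
theorem omega_sub_neg_eq {f : BinQF} (hf : f.disc = Δ.D) :
    ((ω : QO Δ) - ((Δ.D - kOf Δ.D f : ℤ) : QO Δ)) = (ω - (kOf Δ.D f : QO Δ)) + (f.b : QO Δ) := by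
  have hb := b_eq_two_mul_kOf_sub hf (D := Δ.D)
  have hcast : ((f.b : ℤ) : QO Δ) = ((2 * kOf Δ.D f - Δ.D : ℤ) : QO Δ) := by rw [hb]
  push_cast at hcast ⊢
  linear_combination -hcast

/-- Bezout for a primitive form: `u a + v b + w c = 1`. [folklore] -/
theorem exists_bezout_of_isPrimitive {f : BinQF} (hp : f.IsPrimitive) :
    ∃ u v w : ℤ, u * f.a + v * f.b + w * f.c = 1 := by
  unfold BinQF.IsPrimitive at hp
  have h1 : (Int.gcd (Int.gcd f.a f.b : ℤ) f.c : ℤ) = 1 := by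
    rw [Int.gcd, Int.natAbs_natCast, Int.gcd, hp]; rfl
  set g : ℤ := (Int.gcd f.a f.b : ℤ) with hg
  have h2 := Int.gcd_eq_gcd_ab g f.c
  have h3 : g = f.a * Int.gcdA f.a f.b + f.b * Int.gcdB f.a f.b := Int.gcd_eq_gcd_ab f.a f.b
  rw [h1] at h2
  refine ⟨Int.gcdA f.a f.b * Int.gcdA g f.c, Int.gcdB f.a f.b * Int.gcdA g f.c, Int.gcdB g f.c, ?_⟩
  calc Int.gcdA f.a f.b * Int.gcdA g f.c * f.a + Int.gcdB f.a f.b * Int.gcdA g f.c * f.b + Int.gcdB g f.c * f.c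
      = (f.a * Int.gcdA f.a f.b + f.b * Int.gcdB f.a f.b) * Int.gcdA g f.c + f.c * Int.gcdB g f.c := by ring
    _ = g * Int.gcdA g f.c + f.c * Int.gcdB g f.c := by rw [← h3]
    _ = 1 := by exact_mod_cast h2.symm

variable (Δ)

/-- **The ideal of a primitive form is invertible: `𝔞_f · 𝔞_{f̄} = (a)`** (`𝔞_f 𝔞_{f̄} = a (a, ω − k̄, ω − k, c) ∋ a·b` and `gcd(a, b, c) = 1`).
[cite: Cox2013, §7.A Prop. 7.4 and Lemma 7.5] -/
theorem fIdeal_mul_negForm {f : BinQF} (hf : f.IsPosPrim Δ.D) :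
    fIdeal Δ f * fIdeal Δ (negForm f) = Ideal.span {(f.a : QO Δ)} := by
  have hk' := kOf_negForm (Δ := Δ) hf.disc_eq
  set k := kOf Δ.D f with hk
  set θ : QO Δ := ω - (k : QO Δ) with hθ
  set θ' : QO Δ := ω - ((Δ.D - k : ℤ) : QO Δ) with hθ'
  have hprod : θ * θ' = -((f.a * f.c : ℤ) : QO Δ) := omega_sub_mul_omega_sub hf
  have hdiff : θ' = θ + (f.b : QO Δ) := omega_sub_neg_eq hf.disc_eq
  have hneg : fIdeal Δ (negForm f) = Ideal.span {(f.a : QO Δ), θ'} := by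
    rw [fIdeal, hk']; rfl
  rw [hneg, fIdeal, ← hk, ← hθ, Ideal.span_pair_mul_span_pair]
  apply le_antisymm
  · -- every generator is a multiple of `a`
    rw [Ideal.span_le]
    rintro x hx
    simp only [Set.mem_insert_iff, Set.mem_singleton_iff] at hx
    rw [SetLike.mem_coe, Ideal.mem_span_singleton]
    rcases hx with rfl | rfl | rfl | rfl
    · exact dvd_mul_right _ _
    · exact dvd_mul_right _ _
    · exact dvd_mul_left _ _
    · rw [hprod]; push_cast; exact Dvd.dvd.neg_right (dvd_mul_right _ _)
  · -- `a = u a² + v (a θ' − θ a) + w (−θ θ')`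
    rw [Ideal.span_singleton_le_iff_mem]
    obtain ⟨u, v, w, hbez⟩ := exists_bezout_of_isPrimitive hf.primitive
    have hmem1 : (f.a : QO Δ) * (f.a : QO Δ) ∈ Ideal.span {(f.a : QO Δ) * (f.a : QO Δ), (f.a : QO Δ) * θ', θ * (f.a : QO Δ), θ * θ'} :=
      Ideal.subset_span (by simp)
    have hmem2 : (f.a : QO Δ) * θ' ∈ Ideal.span {(f.a : QO Δ) * (f.a : QO Δ), (f.a : QO Δ) * θ', θ * (f.a : QO Δ), θ * θ'} :=
      Ideal.subset_span (by simp)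
    have hmem3 : θ * (f.a : QO Δ) ∈ Ideal.span {(f.a : QO Δ) * (f.a : QO Δ), (f.a : QO Δ) * θ', θ * (f.a : QO Δ), θ * θ'} :=
      Ideal.subset_span (by simp)
    have hmem4 : θ * θ' ∈ Ideal.span {(f.a : QO Δ) * (f.a : QO Δ), (f.a : QO Δ) * θ', θ * (f.a : QO Δ), θ * θ'} :=
      Ideal.subset_span (by simp)
    have key : (f.a : QO Δ) = (u : QO Δ) * ((f.a : QO Δ) * (f.a : QO Δ)) +
        (v : QO Δ) * ((f.a : QO Δ) * θ' - θ * (f.a : QO Δ)) + (-(w : QO Δ)) * (θ * θ') := by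
      have hcast : ((1 : ℤ) : QO Δ) = ((u * f.a + v * f.b + w * f.c : ℤ) : QO Δ) := by rw [hbez]
      rw [hprod, hdiff]
      push_cast at hcast ⊢
      linear_combination (f.a : QO Δ) * hcast
    have hmem : (u : QO Δ) * ((f.a : QO Δ) * (f.a : QO Δ)) +
        (v : QO Δ) * ((f.a : QO Δ) * θ' - θ * (f.a : QO Δ)) + (-(w : QO Δ)) * (θ * θ') ∈
        Ideal.span {(f.a : QO Δ) * (f.a : QO Δ), (f.a : QO Δ) * θ', θ * (f.a : QO Δ), θ * θ'} :=
      Ideal.add_mem _ (Ideal.add_mem _ (Ideal.mul_mem_left _ _ hmem1)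
        (Ideal.mul_mem_left _ _ (Ideal.sub_mem _ hmem2 hmem3))) (Ideal.mul_mem_left _ _ hmem4)
    rw [← key] at hmem
    exact hmem

/-! ### Units of fractional ideals and classes -/

/-- The fraction field of `O_D`. [folklore] -/
abbrev Fr : Type := FractionRing (QO Δ)

/-- `𝔞_f · (a⁻¹ 𝔞_{f̄}) = 1` as fractional ideals. [cite: Cox2013, §7.A Prop. 7.4] -/
theorem coe_fIdeal_mul_inv {f : BinQF} (hf : f.IsPosPrim Δ.D) :
    ((fIdeal Δ f : Ideal (QO Δ)) : FractionalIdeal (QO Δ)⁰ (Fr Δ)) *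
      (FractionalIdeal.spanSingleton (QO Δ)⁰ (algebraMap (QO Δ) (Fr Δ) (f.a : QO Δ))⁻¹ *
        ((fIdeal Δ (negForm f) : Ideal (QO Δ)) : FractionalIdeal (QO Δ)⁰ (Fr Δ))) = 1 := by
  have ha : (algebraMap (QO Δ) (Fr Δ) (f.a : QO Δ)) ≠ 0 := by
    rw [Ne, IsFractionRing.to_map_eq_zero_iff]
    exact intCast_ne_zero Δ hf.a_pos.ne'
  rw [mul_left_comm, ← FractionalIdeal.coeIdeal_mul, fIdeal_mul_negForm Δ hf,
    FractionalIdeal.coeIdeal_span_singleton, FractionalIdeal.spanSingleton_mul_spanSingleton,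
    inv_mul_cancel₀ ha, FractionalIdeal.spanSingleton_one]

/-- The unit fractional ideal of a primitive form. [cite: Cox2013, §7.A Prop. 7.4] -/
def fUnit {f : BinQF} (hf : f.IsPosPrim Δ.D) : (FractionalIdeal (QO Δ)⁰ (Fr Δ))ˣ :=
  Units.mkOfMulEqOne _ _ (coe_fIdeal_mul_inv Δ hf)

/-- The underlying fractional ideal of `fUnit` is `𝔞_f`. [folklore] -/
theorem val_fUnit {f : BinQF} (hf : f.IsPosPrim Δ.D) :
    ((fUnit Δ hf : (FractionalIdeal (QO Δ)⁰ (Fr Δ))ˣ) : FractionalIdeal (QO Δ)⁰ (Fr Δ)) = fIdeal Δ f :=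
  Units.val_mkOfMulEqOne _

open Classical in
/-- **The class of a form in `Cl(O_D)`** (Mathlib's `ClassGroup`: invertible fractional ideals
modulo principal ones); `1` off the primitive positive definite forms of discriminant `D`.
[cite: Cox2013, §7.B Thm. 7.7 (the map form ↦ ideal class, for orders)] -/
def classOf' (f : BinQF) : ClassGroup (QO Δ) :=
  if h : f.IsPosPrim Δ.D then ClassGroup.mk (Fr Δ) (fUnit Δ h) else 1

/-- `classOf' f = [𝔞_f]` on primitive positive definite forms. [folklore] -/
theorem classOf'_eq {f : BinQF} (hf : f.IsPosPrim Δ.D) : classOf' Δ f = ClassGroup.mk (Fr Δ) (fUnit Δ hf) := by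
  rw [classOf', dif_pos hf]

/-- **Equality of classes**: `[𝔞_f] = [𝔞_g]` iff `x 𝔞_f = y 𝔞_g` for some nonzero `x, y ∈ O_D`.
[cite: Cox2013, §7.A (ideal classes of an order)] -/
theorem classOf'_eq_classOf'_iff {f g : BinQF} (hf : f.IsPosPrim Δ.D) (hg : g.IsPosPrim Δ.D) :
    classOf' Δ f = classOf' Δ g ↔ ∃ x y : QO Δ, x ≠ 0 ∧ y ≠ 0 ∧
      Ideal.span {x} * fIdeal Δ f = Ideal.span {y} * fIdeal Δ g := by
  rw [classOf'_eq Δ hf, classOf'_eq Δ hg]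
  exact ClassGroup.mk_eq_mk_of_coe_ideal (val_fUnit Δ hf) (val_fUnit Δ hg)

/-- `[𝔞_f] = 1` iff `𝔞_f` is principal. [folklore] -/
theorem classOf'_eq_one_iff {f : BinQF} (hf : f.IsPosPrim Δ.D) :
    classOf' Δ f = 1 ↔ ∃ x : QO Δ, x ≠ 0 ∧ fIdeal Δ f = Ideal.span {x} := by
  rw [classOf'_eq Δ hf]
  exact ClassGroup.mk_eq_one_of_coe_ideal (val_fUnit Δ hf)

/-- The principal form has the trivial class. [cite: Cox2013, §7.B Thm. 7.7] -/
theorem classOf'_one (hD4 : Δ.D % 4 = 0 ∨ Δ.D % 4 = 1) : classOf' Δ (FormComposition.one Δ.D) = 1 := by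
  have h1 := (isPosPrim_one Δ.neg hD4).1
  rw [classOf'_eq_one_iff Δ h1]
  refine ⟨1, one_ne_zero, ?_⟩
  rw [Ideal.span_singleton_one, fIdeal, Ideal.eq_top_iff_one]
  refine Ideal.subset_span (Set.mem_insert_iff.2 (Or.inl ?_))
  rw [one_a]; simp

/-- **The opposite form is the inverse**: `[𝔞_f][𝔞_{f̄}] = 1`. [cite: Cox2013, §7.A Prop. 7.4] -/
theorem classOf'_mul_negForm {f : BinQF} (hf : f.IsPosPrim Δ.D) :
    classOf' Δ f * classOf' Δ (negForm f) = 1 := by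
  have hn := isPosPrim_negForm hf
  rw [classOf'_eq Δ hf, classOf'_eq Δ hn, ← map_mul]
  refine (ClassGroup.mk_eq_one_of_coe_ideal (I' := fIdeal Δ f * fIdeal Δ (negForm f)) ?_).2
    ⟨(f.a : QO Δ), intCast_ne_zero Δ hf.a_pos.ne', fIdeal_mul_negForm Δ hf⟩
  rw [Units.val_mul, val_fUnit, val_fUnit, FractionalIdeal.coeIdeal_mul]

/-! ### Composition: primitivity for every `D < 0`, and multiplicativity of classes -/

/-- The ideal of the raw composite and the factorisation `𝔞_f 𝔞_g = (δ) 𝔞_{f∘g}`. [cite: Cox2013, §3.A and §7.B] -/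
theorem fIdeal_mul_eq {f g : BinQF} (hf : f.IsPosPrim Δ.D) (hg : g.IsPosPrim Δ.D) :
    fIdeal Δ f * fIdeal Δ g =
      Ideal.span {(compD Δ.D (mOf Δ.D) f.a (kOf Δ.D f) g.a (kOf Δ.D g) : QO Δ)} *
        fIdeal Δ (rawCompose Δ.D f g) := by
  have hD4 := hf.emod_four
  have hn₁ := norm_eq hf.disc_eq hD4
  have hn₂ := norm_eq hg.disc_eq hD4
  have h := mul_eq_span_singleton_mul (qbasis Δ) (qbasis_zero Δ) (qbasis_rel Δ) hf.a_pos.ne' hn₁ hn₂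
  rw [qbasis_one] at h
  rw [fIdeal, fIdeal, h, fIdeal, kOf_rawCompose]
  rfl

/-- **The raw composite is primitive positive definite of discriminant `D`, for every `D < 0`**
(Cox Lemma 7.5 via invertibility: if `e | A, B, C` then `θ = ω − K` satisfies `θ 𝔞 ⊆ e 𝔞`,
`𝔞 = 𝔞_{f∘g}`; multiplying by `𝔞' = δ 𝔞_{f̄} 𝔞_{ḡ}` with `𝔞 𝔞' = (a a')` gives `e ∣ θ` in
`O_D`, so `e = ±1`). [cite: Cox2013, §7.A Lemma 7.5 and §3.A] -/
theorem isPosPrim_rawCompose' {f g : BinQF} (hf : f.IsPosPrim Δ.D) (hg : g.IsPosPrim Δ.D) :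
    (rawCompose Δ.D f g).IsPosPrim Δ.D := by
  set D := Δ.D with hD
  have hD4 : D % 4 = 0 ∨ D % 4 = 1 := hf.emod_four
  have hn₁ := norm_eq hf.disc_eq hD4
  have hn₂ := norm_eq hg.disc_eq hD4
  have ha₁ := hf.a_pos
  have ha₂ := hg.a_pos
  set A := compA D (mOf D) f.a (kOf D f) g.a (kOf D g) with hA
  set K := compK D (mOf D) f.a (kOf D f) g.a (kOf D g) with hK
  set δ := compD D (mOf D) f.a (kOf D f) g.a (kOf D g) with hδ
  obtain ⟨C₃, hC₃⟩ := compA_dvd (qbasis Δ) (qbasis_zero Δ) (qbasis_rel Δ) ha₁.ne' hn₁ hn₂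
  rw [← hA, ← hK] at hC₃
  have hApos : 0 < A := compA_pos (qbasis Δ) (qbasis_zero Δ) (qbasis_rel Δ) ha₁.ne' ha₂.ne' hn₁ hn₂
  have hc : (rawCompose D f g).c = C₃ := by
    show (K ^ 2 - D * K - mOf D) / A = C₃
    rw [hC₃, Int.mul_ediv_cancel_left _ hApos.ne']
  have hdisc : (rawCompose D f g).disc = D := by
    show (2 * K - D) ^ 2 - 4 * A * ((K ^ 2 - D * K - mOf D) / A) = D
    rw [show (K ^ 2 - D * K - mOf D) / A = C₃ from hc]
    have := sq_add_four_mul_mOf hD4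
    nlinarith [hC₃]
  refine ⟨hdisc, hApos, ?_⟩
  -- primitivity
  rw [BinQF.isPrimitive_iff]
  intro e heA heB heC
  have hea : (rawCompose D f g).a = A := rfl
  have heb : (rawCompose D f g).b = 2 * K - D := rfl
  rw [hea] at heA; rw [heb] at heB; rw [hc] at heC
  have he0 : e ≠ 0 := by rintro rfl; rw [zero_dvd_iff] at heA; exact hApos.ne' heA
  -- `θ 𝔞 ≤ e 𝔞`
  set θ : QO Δ := ω - (K : QO Δ) with hθ
  have hkraw : kOf D (rawCompose D f g) = K := kOf_rawCompose D f g
  have h𝔞 : fIdeal Δ (rawCompose D f g) = Ideal.span {(A : QO Δ), θ} := by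
    rw [fIdeal, hkraw]; rfl
  have hθsq : θ * θ = -(((2 * K - D : ℤ) : QO Δ)) * θ - ((A * C₃ : ℤ) : QO Δ) := by
    have hω := omega_mul_omega Δ
    have hcast : ((A * C₃ : ℤ) : QO Δ) = ((K ^ 2 - D * K - mOf D : ℤ) : QO Δ) := by rw [hC₃]
    push_cast at hcast ⊢
    rw [hθ]
    linear_combination hω + hcast
  obtain ⟨qA, hqA⟩ := heA
  obtain ⟨qB, hqB⟩ := heB
  obtain ⟨qC, hqC⟩ := heC
  have hle : Ideal.span {θ} * Ideal.span {(A : QO Δ), θ} ≤ Ideal.span {(e : QO Δ)} * Ideal.span {(A : QO Δ), θ} := by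
    rw [Ideal.mul_le]
    intro x hx y hy
    rw [Ideal.mem_span_singleton] at hx
    obtain ⟨x', rfl⟩ := hx
    rw [mul_comm θ x', mul_assoc]
    refine Ideal.mul_mem_left _ _ ?_
    have hyA : θ * (A : QO Δ) ∈ Ideal.span {(e : QO Δ)} * Ideal.span {(A : QO Δ), θ} := by
      have : θ * (A : QO Δ) = (e : QO Δ) * ((qA : QO Δ) * θ) := by
        have : ((A : ℤ) : QO Δ) = ((e * qA : ℤ) : QO Δ) := by rw [hqA]
        push_cast at this; rw [this]; ring
      rw [this]
      exact Ideal.mul_mem_mul (Ideal.mem_span_singleton_self _)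
        (Ideal.mul_mem_left _ _ (Ideal.subset_span (by simp)))
    have hyθ : θ * θ ∈ Ideal.span {(e : QO Δ)} * Ideal.span {(A : QO Δ), θ} := by
      have : θ * θ = (e : QO Δ) * (-(qB : QO Δ) * θ + -((qC : ℤ) : QO Δ) * (A : QO Δ)) := by
        rw [hθsq]
        have h1 : ((2 * K - D : ℤ) : QO Δ) = ((e * qB : ℤ) : QO Δ) := by rw [hqB]
        have h2 : ((A * C₃ : ℤ) : QO Δ) = ((A * (e * qC) : ℤ) : QO Δ) := by rw [hqC]
        rw [h1, h2]; push_cast; ring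
      rw [this]
      exact Ideal.mul_mem_mul (Ideal.mem_span_singleton_self _)
        (Ideal.add_mem _ (Ideal.mul_mem_left _ _ (Ideal.subset_span (by simp)))
          (Ideal.mul_mem_left _ _ (Ideal.subset_span (by simp))))
    -- `y ∈ (A, θ)`
    refine Submodule.span_induction (p := fun y _ => θ * y ∈ Ideal.span {(e : QO Δ)} * Ideal.span {(A : QO Δ), θ}) ?_ ?_ ?_ ?_ hy
    · intro y hy
      simp only [Set.mem_insert_iff, Set.mem_singleton_iff] at hy
      rcases hy with rfl | rfl
      · exact hyA
      · exact hyθ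
    · simp
    · intro y z _ _ hy hz; rw [mul_add]; exact Ideal.add_mem _ hy hz
    · intro r y _ hy; rw [smul_eq_mul, mul_left_comm]; exact Ideal.mul_mem_left _ _ hy
  -- multiply by `𝔞' = δ 𝔞_{f̄} 𝔞_{ḡ}`: `𝔞 𝔞' = (a a')`
  set J := Ideal.span {(δ : QO Δ)} * (fIdeal Δ (negForm f) * fIdeal Δ (negForm g)) with hJ
  have hprod : Ideal.span {(A : QO Δ), θ} * J = Ideal.span {((f.a * g.a : ℤ) : QO Δ)} := by
    have h1 := fIdeal_mul_eq Δ hf hg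
    rw [h𝔞] at h1
    have h2 := fIdeal_mul_negForm Δ hf
    have h3 := fIdeal_mul_negForm Δ hg
    calc Ideal.span {(A : QO Δ), θ} * J
        = (Ideal.span {(δ : QO Δ)} * Ideal.span {(A : QO Δ), θ}) * (fIdeal Δ (negForm f) * fIdeal Δ (negForm g)) := by
          rw [hJ]; ring
      _ = (fIdeal Δ f * fIdeal Δ (negForm f)) * (fIdeal Δ g * fIdeal Δ (negForm g)) := by rw [← h1]; ring
      _ = Ideal.span {((f.a * g.a : ℤ) : QO Δ)} := by
          rw [h2, h3, Ideal.span_singleton_mul_span_singleton]; push_cast; rfl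
  have hle2 := Ideal.mul_mono_left (K := J) hle
  rw [mul_assoc, mul_assoc, hprod, Ideal.span_singleton_mul_span_singleton,
    Ideal.span_singleton_mul_span_singleton, Ideal.span_singleton_le_span_singleton] at hle2
  -- cancel `a a' ≠ 0`
  have haa : ((f.a * g.a : ℤ) : QO Δ) ≠ 0 := intCast_ne_zero Δ (mul_ne_zero ha₁.ne' ha₂.ne')
  have hdvd : (e : QO Δ) ∣ θ := (mul_dvd_mul_iff_right haa).1 hle2
  rw [intCast_dvd_iff] at hdvd
  have him : θ.im = 1 := by simp [hθ, omega]
  rw [him] at hdvd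
  exact isUnit_of_dvd_one hdvd.2

/-! ### Invariance of the class under the Gauss moves, and composition -/

/-- `span {x} · span {y, z} = span {x y, x z}`. [folklore] -/
theorem span_singleton_mul_span_pair {R : Type*} [CommRing R] (x y z : R) :
    Ideal.span {x} * Ideal.span {y, z} = Ideal.span {x * y, x * z} := by
  have h1 : (Ideal.span {x} : Ideal R) = Ideal.span {x, x} := by
    rw [show ({x, x} : Set R) = {x} from Set.pair_eq_singleton x]
  rw [h1, Ideal.span_pair_mul_span_pair]
  congr 1
  ext w
  simp only [Set.mem_insert_iff, Set.mem_singleton_iff]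
  tauto

/-- `k(f·T^n) = k(f) + a n`. [folklore] -/
theorem kOf_normalizeB (f : BinQF) : kOf Δ.D (normalizeB f) = kOf Δ.D f + f.a * normShift f := by
  simp only [kOf, normalizeB]
  rw [show f.b + 2 * f.a * normShift f + Δ.D = f.b + Δ.D + f.a * normShift f * 2 by ring,
    Int.add_mul_ediv_right _ _ two_ne_zero]

/-- **Translation does not change the ideal**: `𝔞_{f·T^n} = 𝔞_f`. [cite: Cox2013, §7.B Thm. 7.7 (proof)] -/
theorem fIdeal_normalizeB (f : BinQF) : fIdeal Δ (normalizeB f) = fIdeal Δ f := by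
  rw [fIdeal, fIdeal, kOf_normalizeB, normalizeB_a]
  push_cast
  rw [show (ω : QO Δ) - ((kOf Δ.D f : QO Δ) + (f.a : QO Δ) * (normShift f : QO Δ)) =
    (ω - (kOf Δ.D f : QO Δ)) - (normShift f : QO Δ) * (f.a : QO Δ) by ring, Ideal.span_pair_sub_mul_left]

/-- `k(f·S) = D − k(f)`. [folklore] -/
theorem kOf_swapS {f : BinQF} (hf : f.disc = Δ.D) : kOf Δ.D (swapS f) = Δ.D - kOf Δ.D f := by
  have h1 := two_mul_kOf hf
  have h2 := two_mul_kOf (show (swapS f).disc = Δ.D by rw [← hf]; simp [swapS, BinQF.disc]; ring)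
  have hb : (swapS f).b = -f.b := rfl
  rw [hb] at h2
  linarith

/-- **The swap changes the ideal by a principal factor**: `(ω − k) 𝔞_{f·S} = c 𝔞_f`.
[cite: Cox2013, §7.B Thm. 7.7 (proof, (7.16))] -/
theorem span_mul_fIdeal_swapS {f : BinQF} (hf : f.IsPosPrim Δ.D) :
    Ideal.span {(ω : QO Δ) - (kOf Δ.D f : QO Δ)} * fIdeal Δ (swapS f) =
      Ideal.span {(f.c : QO Δ)} * fIdeal Δ f := by
  have hprod := omega_sub_mul_omega_sub hf
  rw [fIdeal, kOf_swapS Δ hf.disc_eq, fIdeal, span_singleton_mul_span_pair, span_singleton_mul_span_pair,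
    hprod, show (swapS f).a = f.c from rfl]
  push_cast
  rw [Ideal.span_pair_neg, Ideal.span_pair_comm, mul_comm ((ω : QO Δ) - (kOf Δ.D f : QO Δ)) (f.c : QO Δ),
    mul_comm (f.a : QO Δ) (f.c : QO Δ)]

/-- `classOf'` is invariant under translation. [folklore] -/
theorem classOf'_normalizeB {f : BinQF} (hf : f.IsPosPrim Δ.D) : classOf' Δ (normalizeB f) = classOf' Δ f := by
  have hn : (normalizeB f).IsPosPrim Δ.D := (properEquiv_normalizeB f).isPosPrim Δ.neg hf
  rw [classOf'_eq_classOf'_iff Δ hn hf]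
  exact ⟨1, 1, one_ne_zero, one_ne_zero, by rw [fIdeal_normalizeB]⟩

/-- `classOf'` is invariant under the swap. [folklore] -/
theorem classOf'_swapS {f : BinQF} (hf : f.IsPosPrim Δ.D) : classOf' Δ (swapS f) = classOf' Δ f := by
  have hs : (swapS f).IsPosPrim Δ.D := f.properEquiv_S.isPosPrim Δ.neg hf
  rw [classOf'_eq_classOf'_iff Δ hs hf]
  refine ⟨(ω : QO Δ) - (kOf Δ.D f : QO Δ), (f.c : QO Δ), ?_, intCast_ne_zero Δ (IsPosPrim.c_pos f Δ.neg hf).ne',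
    span_mul_fIdeal_swapS Δ hf⟩
  intro h
  have := congrArg QuadraticAlgebra.im h
  simp [omega] at this

/-- **`classOf'` is invariant under a Gauss step**, hence under `reduce`. [cite: Cox2013, §7.B Thm. 7.7] -/
theorem classOf'_step {f : BinQF} (hf : f.IsPosPrim Δ.D) : classOf' Δ (step f) = classOf' Δ f := by
  unfold step
  split_ifs with h
  · rw [classOf'_swapS Δ ((properEquiv_normalizeB f).isPosPrim Δ.neg hf), classOf'_normalizeB Δ hf]
  · exact classOf'_normalizeB Δ hf

/-- Iterated steps. [folklore] -/
theorem classOf'_step_iterate {f : BinQF} (hf : f.IsPosPrim Δ.D) : ∀ n : ℕ, classOf' Δ (step^[n] f) = classOf' Δ f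
  | 0 => rfl
  | n + 1 => by
    rw [Function.iterate_succ_apply', classOf'_step Δ (isPosPrim_step_iterate Δ.neg hf n),
      classOf'_step_iterate hf n]

/-- **`classOf' (reduce f) = classOf' f`.** [cite: Cox2013, §7.B Thm. 7.7 and §2.A Thm. 2.8] -/
theorem classOf'_reduce {f : BinQF} (hf : f.IsPosPrim Δ.D) : classOf' Δ (reduce f) = classOf' Δ f :=
  classOf'_step_iterate Δ hf _

/-- **Composition multiplies classes** (raw composite). [cite: Cox2013, §7.B Thm. 7.7 and §3.A] -/
theorem classOf'_rawCompose {f g : BinQF} (hf : f.IsPosPrim Δ.D) (hg : g.IsPosPrim Δ.D) :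
    classOf' Δ (rawCompose Δ.D f g) = classOf' Δ f * classOf' Δ g := by
  have hr := isPosPrim_rawCompose' Δ hf hg
  rw [classOf'_eq Δ hr, classOf'_eq Δ hf, classOf'_eq Δ hg, ← map_mul]
  refine (ClassGroup.mk_eq_mk_of_coe_ideal (I' := fIdeal Δ (rawCompose Δ.D f g))
    (J' := fIdeal Δ f * fIdeal Δ g) (val_fUnit Δ hr) ?_).2 ?_
  · rw [Units.val_mul, val_fUnit, val_fUnit, FractionalIdeal.coeIdeal_mul]
  · refine ⟨(compD Δ.D (mOf Δ.D) f.a (kOf Δ.D f) g.a (kOf Δ.D g) : QO Δ), 1,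
      intCast_ne_zero Δ (compD_pos hf.a_pos.ne').ne', one_ne_zero, ?_⟩
    rw [Ideal.span_singleton_one, Ideal.top_mul, fIdeal_mul_eq Δ hf hg]

/-- **`[𝔞_{compose f g}] = [𝔞_f][𝔞_g]` in `Cl(O_D)`, for every `D < 0`.** [cite: Cox2013, §7.B Thm. 7.7 and §3.A] -/
theorem classOf'_compose {f g : BinQF} (hf : f.IsPosPrim Δ.D) (hg : g.IsPosPrim Δ.D) :
    classOf' Δ (compose Δ.D f g) = classOf' Δ f * classOf' Δ g := by
  rw [compose, classOf'_reduce Δ (isPosPrim_rawCompose' Δ hf hg), classOf'_rawCompose Δ hf hg]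

/-- `compose f g` is primitive positive definite of discriminant `D`, for every `D < 0`. [cite: Cox2013, §3.A] -/
theorem isPosPrim_compose' {f g : BinQF} (hf : f.IsPosPrim Δ.D) (hg : g.IsPosPrim Δ.D) :
    (compose Δ.D f g).IsPosPrim Δ.D :=
  isPosPrim_reduce Δ.neg (isPosPrim_rawCompose' Δ hf hg)

/-- `compose f g` is reduced. [cite: Cox2013, §2.A Thm. 2.8] -/
theorem isReduced_compose' {f g : BinQF} (hf : f.IsPosPrim Δ.D) (hg : g.IsPosPrim Δ.D) :
    (compose Δ.D f g).IsReduced :=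
  isReduced_reduce Δ.neg (isPosPrim_rawCompose' Δ hf hg)

/-- `negForm` then `reduce` is the inverse class, as a reduced form. [cite: Cox2013, §3.A] -/
theorem classOf'_reduce_negForm {f : BinQF} (hf : f.IsPosPrim Δ.D) :
    classOf' Δ f * classOf' Δ (reduce (negForm f)) = 1 := by
  rw [classOf'_reduce Δ (isPosPrim_negForm hf), classOf'_mul_negForm Δ hf]

/-- Powers: `formPow f e` has class `[f]^e` and is reduced primitive positive definite
(`e ≥ 1`, or `D ≡ 0,1 (mod 4)` for `e = 0`). [cite: Cox2013, §3.A] -/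
theorem formPow_spec' {f : BinQF} (hf : f.IsPosPrim Δ.D) :
    ∀ e : ℕ, (formPow Δ.D f e).IsPosPrim Δ.D ∧ (formPow Δ.D f e).IsReduced ∧
      classOf' Δ (formPow Δ.D f e) = classOf' Δ f ^ e
  | 0 => by
    obtain ⟨h1, h2⟩ := isPosPrim_one Δ.neg hf.emod_four
    exact ⟨h1, h2, by rw [pow_zero]; exact classOf'_one Δ hf.emod_four⟩
  | e + 1 => by
    obtain ⟨h1, -, h3⟩ := formPow_spec' hf e
    refine ⟨isPosPrim_compose' Δ h1 hf, isReduced_compose' Δ h1 hf, ?_⟩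
    show classOf' Δ (compose _ (formPow _ f e) f) = _
    rw [classOf'_compose Δ h1 hf, h3, pow_succ]

end OrderCl

end Literature.Computability.Cryptography.Hallgren2005

end
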